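import Summits.BirchSwinnertonDyer.Rank1Residual.GaloisImage.PrimeChoiceSakamoto
import HarnessLib

/-!
# Sakamoto's prime choice INSIDE A PRESCRIBED FROBENIUS COSET (the "thinned" prime-choice TOOL):
# infinitely many `𝔮 ∈ 𝒫` with `loc_𝔮 cᵢ ≠ 0` AND `Frob_𝔮 ∈ τ·𝒰` for an open normal subgroup `𝒰`
# (cell `b2b-bsdres`, team n1011; planner r1 GEN 48 END-b ruling (C)(a2); seat n1011-p11 GEN 12, row T-PC-THIN)

HONEST FRAMING (cell `b2b-bsdres`, run/shared/lean/b2b/bsd-rank1-residual/, verbatim in every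
file): the goal of the cell is to DELETE the COMBINATION-SHAPED residual classes of the
Birch–Swinnerton-Dyer formula for ALL analytic-rank `≤ 1` elliptic curves over `ℚ` — "full BSD
formula for every rank `≤ 1` curve in class `C`" assembled STRICTLY from published theorems — so
that the rank-`≤ 1` remainder becomes exactly the CONSTRUCTION-SHAPED classes, which are TYPED
(missing-input `Prop`s), NOT attempted. This is not "finishing BSD". Team n1011 (N10/N11, the
additive block `X4 ∧ p = 3`): research route on the CONSTRUCTION-SHAPED class X4 / §I N11
(route-1 PORT, END-b); TOOL theorems about Galois cohomology classes of a finite Galois module, no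
class theorem, nothing booked, no mark / label changed; no definition, no named fact, no `sorry`.
The one deep input, Chebotarev, is the tree's PROVED `absoluteGaloisGroup.frobenius_dense`, as in
`PrimeChoiceSakamoto.lean` (T-C55K, n1011-p15), which this file generalises: `Gal(K̄/K(μ_N))` ↦ `𝒰`.

## Why / what (planner r1 GEN 48, cell INBOX 2026-08-22T11:02Z (C)(a2); ROUTE-1 §60.2 (i))
END-b (the twin of T-PK6-M1-END on the rows with a `3`-anomalous bad place; n1011-p13) needs its
Kolyvagin primes `q` in a THINNER set than Sakamoto's `τ`-class `𝒫`: besides `Frob_q ∼ τ` on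
`E[3]` and on `μ₃`, every `3`-anomalous bad prime `w` must be a cube mod `q` and `q ≢ 1 (mod 9)`
— conditions on the restriction of `Frob_q` to a finite Galois extension `K′ = ℚ(μ₉, {w^{1/3}})`,
i.e. "`Frob_q ∈ τ·Gal(ℚ̄/K′)`" for a `τ` that ALSO does the right thing on `K′` (r1: "a THINNED
PRIME-CHOICE TOOL: Chebotarev in `ℚ(E[3], F_c, μ₉, B^{1/3})` … same file pattern as
`PrimeChoiceSakamoto`, bigger field").  This file is that tool in GROUP-THEORETIC form, for ANY
open normal subgroup `𝒰 ≤ Gal(K̄/K(μ_N))` (the consumer takes `𝒰 = Gal(K̄/K(μ_N)) ⊓ Gal(K̄/K′)`);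
the EXISTENCE of a `τ` with (H.2) on `T̄` and the wanted behaviour on `K′` — where r1's rider
(R-v) KUMMER–Δ OBSTRUCTION (`ℚ(E[3]) ⊇ ℚ(μ₃, ∛Δ_E)`) decides — is NOT claimed: `τ` is a binder.

Setting: `K` a number field (any field in §1, §3), `ρ` a FINITE discrete `Γ_K`-module on `M`
(= `T̄`), a prime `p`, `N ≠ 0`, `S` finite, `τ ∈ Γ_K` with `T̄/(τ − 1)T̄ ≃ ℤ/p` ((H.2)), (H.1)
`hirr` (no `ρ`-stable subgroup other than `⊥`, `⊤`), and (H.3)^𝒰 `hH3`: every continuous crossed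
homomorphism vanishing on `ker ρ ⊓ 𝒰` is principal (`𝒰 = Gal(K̄/K(μ_N))`: VERBATIM T-C55K's (H.3)).
* §1 `oneCocycleClass_eq_zero_of_forall_mem_subgroup_apply_mem_range` (KEY LEMMA) and
  ★ `exists_mem_subgroup_forall_apply_mul_notMem_range` (THE SELECTION, `γ ∈ ker ρ ⊓ 𝒰`) —
  T-C55K file 2 with `Gal(K̄/K(μ_N))` replaced by a normal `𝒰`, token for token.
* §2 ★★ `exists_mem_frobeniusClassPrimes_notMem_forall_localization_ne_zero_of_subgroup`,
  ★★ `infinite_setOf_mem_frobeniusClassPrimes_forall_localization_ne_zero_of_subgroup`: for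
  `n ≤ p` non-zero classes, INFINITELY many `𝔮 ∈ frobeniusClassPrimes ρ S τ N` have `loc_𝔮 cᵢ ≠ 0`
  for all `i` AND an arithmetic Frobenius `σ` above `𝔮` with `σ τ⁻¹ ∈ ker ρ ⊓ 𝒰` — T-C55K file 4
  with the open set `U ∋ τγ` shrunk by the (open) clause `(τγ)⁻¹σ ∈ 𝒰`.
* §3 ★ `hH3_inf_of_hH3` — (H.3)^{𝒰₀ ⊓ 𝒦} from (H.3)^{𝒰₀} when the commutators `[𝒱, ker ρ ⊓ 𝒰₀]`
  lie in the normal subgroup `𝒦` (`hcomm`: "`K′/K(μ₃)` abelian") and `T̄^{ρ(𝒱)} = 0` (`hfix`: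
  `E[3]^{SL₂(𝔽₃)} = 0`): on `ker ρ ⊓ 𝒰₀` a cocycle is an equivariant homomorphism, so
  `ρ(g) f(u) = f(g u g⁻¹) = f([g,u] u) = f(u)` (normality of `Gal(K̄/K(μ_N))`: `InflRes.normal_rootsOfUnityFixer`).
References: R. Sakamoto, JTNB 36 (2024), Lemma 5.2, Cor. 5.5 (pp. 928–930); B. Mazur, K. Rubin,
Mem. AMS 799 (2004), Prop. 3.6.1 (pp. 30–31); J.-P. Serre, *Abelian ℓ-adic representations* (1968)
Ch. I §2.2 (Frobenius density); cells/n1011/ROUTE-1.md §60.2 (i).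
-/

noncomputable section

open Function Field NumberField IsDedekindDomain Filter Topology
open Literature.NumberTheory.GaloisRepresentations Literature.NumberTheory.GaloisCohomology
open scoped NumberField Pointwise

namespace Summit.BirchSwinnertonDyer.Rank1Residual.GaloisImage.PrimeChoice

variable {K : Type} [Field K] {M : Type} [AddCommGroup M] [TopologicalSpace M]
  [DiscreteTopology M] (ρ : DiscreteGaloisModule K M)

/-! ## §1 The selection relative to an arbitrary normal subgroup `𝒰` (cocycle algebra, any field) -/

/-- **KEY LEMMA relative to `𝒰`.** Under (H.1) and (H.3)^𝒰: if a continuous crossed homomorphism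
`c : Γ_K → T̄` takes values in `(τ − 1)T̄` on `ker ρ ⊓ 𝒰` (`𝒰` a normal subgroup of `Γ_K`) and
`T̄/(τ − 1)T̄ ≃ ℤ/p`, then `[c] = 0`: the image `c(ker ρ ⊓ 𝒰)` is a `ρ`-stable subgroup
(equivariance `c(s g s⁻¹) = ρ(s) c(g)` and normality of `𝒰`) inside the proper subgroup
`(τ − 1)T̄`, hence `0` by (H.1); then (H.3)^𝒰.  T-C55K file 2's key lemma is the case
`𝒰 = Gal(K̄/K(μ_N))`. [cite: Sakamoto2024, Lemma 5.2 (p. 928)]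
[cite: MazurRubin2004, Prop. 3.6.1 proof, p. 31] -/
theorem oneCocycleClass_eq_zero_of_forall_mem_subgroup_apply_mem_range {p : ℕ} [Fact p.Prime]
    (𝒰 : Subgroup (absoluteGaloisGroup K)) [𝒰.Normal]
    {τ : absoluteGaloisGroup K} (e : cokerSubOne ρ τ ≃+ ZMod p)
    (hirr : ∀ A : AddSubgroup M,
      (∀ (s : absoluteGaloisGroup K), ∀ m ∈ A, ρ s m ∈ A) → A = ⊥ ∨ A = ⊤)
    (hH3 : ∀ f : contOneCocycles ρ.toTopRep,
      (∀ u : absoluteGaloisGroup K, ρ u = 1 → u ∈ 𝒰 → f.1 u = 0) →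
        oneCocycleClass ρ.toTopRep f = 0)
    (c : contOneCocycles ρ.toTopRep)
    (hc : ∀ g : absoluteGaloisGroup K, ρ g = 1 → g ∈ 𝒰 →
      c.1 g ∈ ((ρ τ).toAddMonoidHom - AddMonoidHom.id M).range) :
    oneCocycleClass ρ.toTopRep c = 0 := by
  -- the image of `ker ρ ⊓ 𝒰` under `c`, a `ρ`-stable subgroup
  let A : AddSubgroup M :=
    { carrier := {m | ∃ g : absoluteGaloisGroup K, ρ g = 1 ∧ g ∈ 𝒰 ∧ c.1 g = m}
      zero_mem' := ⟨1, map_one ρ, Subgroup.one_mem _, contOneCocycles.apply_one c⟩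
      add_mem' := by
        rintro _ _ ⟨g, hg, hgU, rfl⟩ ⟨h, hh, hhU, rfl⟩
        exact ⟨g * h, by rw [map_mul, hg, hh, mul_one], Subgroup.mul_mem _ hgU hhU,
          apply_mul_of_apply_eq_one c hg h⟩
      neg_mem' := by
        rintro _ ⟨g, hg, hgU, rfl⟩
        have hinv : ρ g⁻¹ = 1 := by
          have h := map_mul ρ g⁻¹ g
          rw [inv_mul_cancel, map_one, hg, mul_one] at h
          exact h.symm
        exact ⟨g⁻¹, hinv, Subgroup.inv_mem _ hgU, apply_inv_of_apply_eq_one c hg⟩ }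
  have hAstab : ∀ (s : absoluteGaloisGroup K), ∀ m ∈ A, ρ s m ∈ A := by
    rintro s _ ⟨g, hg, hgU, rfl⟩
    refine ⟨s * g * s⁻¹, ?_, Subgroup.Normal.conj_mem inferInstance g hgU s,
      apply_conj_of_apply_eq_one c hg s⟩
    rw [map_mul, map_mul, hg, mul_one, ← map_mul, mul_inv_cancel, map_one]
  have hAle : A ≤ ((ρ τ).toAddMonoidHom - AddMonoidHom.id M).range := by
    rintro _ ⟨g, hg, hgU, rfl⟩
    exact hc g hg hgU
  have hAbot : A = ⊥ := by
    rcases hirr A hAstab with h | h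
    · exact h
    · exact absurd (top_le_iff.mp (h ▸ hAle)) (range_sub_id_ne_top e)
  refine hH3 c fun u hu hU => ?_
  have hmem : c.1 u ∈ A := ⟨u, hu, hU, rfl⟩
  rw [hAbot] at hmem
  exact (AddSubgroup.mem_bot).mp hmem

/-- **THE SELECTION relative to `𝒰`** (T-C55K file 2's `exists_forall_apply_mul_notMem_range` with
`Gal(K̄/K(μ_N))` replaced by a normal subgroup `𝒰`): under (H.1), (H.2) for `τ` and (H.3)^𝒰, for
`n ≤ p` continuous crossed homomorphisms `c₁, …, cₙ : Γ_K → T̄` with NON-ZERO classes there is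
`γ ∈ ker ρ ⊓ 𝒰` with `cᵢ(τ γ) ∉ (τ − 1)T̄` for every `i` (file 1's covering lemma applied to the
homomorphisms `cᵢ|_{ker ρ ⊓ 𝒰} mod (τ − 1)T̄` and the constants `cᵢ(τ) mod (τ − 1)T̄`).
[cite: Sakamoto2024, Lemma 5.2 (p. 928)] [cite: MazurRubin2004, Prop. 3.6.1 proof, p. 31] -/
theorem exists_mem_subgroup_forall_apply_mul_notMem_range {p : ℕ} [Fact p.Prime]
    (𝒰 : Subgroup (absoluteGaloisGroup K)) [𝒰.Normal]
    {τ : absoluteGaloisGroup K} (e : cokerSubOne ρ τ ≃+ ZMod p)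
    (hirr : ∀ A : AddSubgroup M,
      (∀ (s : absoluteGaloisGroup K), ∀ m ∈ A, ρ s m ∈ A) → A = ⊥ ∨ A = ⊤)
    (hH3 : ∀ f : contOneCocycles ρ.toTopRep,
      (∀ u : absoluteGaloisGroup K, ρ u = 1 → u ∈ 𝒰 → f.1 u = 0) →
        oneCocycleClass ρ.toTopRep f = 0)
    {n : ℕ} (hn : n ≤ p) (c : Fin n → contOneCocycles ρ.toTopRep)
    (hc : ∀ i, oneCocycleClass ρ.toTopRep (c i) ≠ 0) :
    ∃ γ : absoluteGaloisGroup K, ρ γ = 1 ∧ γ ∈ 𝒰 ∧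
      ∀ i, (c i).1 (τ * γ) ∉ ((ρ τ).toAddMonoidHom - AddMonoidHom.id M).range := by
  classical
  -- the group `ker ρ ⊓ 𝒰` as a subgroup
  set GF : Subgroup (absoluteGaloisGroup K) := ρ.ker ⊓ 𝒰 with hGF_def
  have hmemGF : ∀ g : absoluteGaloisGroup K, g ∈ GF ↔ ρ g = 1 ∧ g ∈ 𝒰 :=
    fun g => by rw [hGF_def, Subgroup.mem_inf, ContinuousRep.mem_ker]; exact Iff.rfl
  set R : AddSubgroup M := ((ρ τ).toAddMonoidHom - AddMonoidHom.id M).range with hR_def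
  -- `π = e ∘ (mod (τ − 1)T̄) : T̄ → 𝔽_p`
  let π : M →+ ZMod p := e.toAddMonoidHom.comp (QuotientAddGroup.mk' R)
  have hπ : ∀ m, π m = e (QuotientAddGroup.mk m) := fun m => rfl
  have hπ0 : ∀ m, π m = 0 ↔ m ∈ R := fun m => by
    rw [hπ, e.map_eq_zero_iff, QuotientAddGroup.eq_zero_iff]
  -- the data of file 1's selection lemma
  let E : Fin n → (↥GF → ZMod p) := fun i g => π ((c i).1 g)
  let F : (Fin n → ZMod p) →ₗ[ZMod p] (↥GF → ZMod p) := Fintype.linearCombination (ZMod p) E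
  let Λ : (Fin n → ZMod p) →ₗ[ZMod p] ZMod p :=
    Fintype.linearCombination (ZMod p) fun i => π ((c i).1 τ)
  have hFapply : ∀ a (g : GF), F a g = ∑ i, a i * π ((c i).1 g) := fun a g => by
    change (Fintype.linearCombination (ZMod p) E a) g = _
    rw [Fintype.linearCombination_apply, Finset.sum_apply]
    simp only [Pi.smul_apply, smul_eq_mul, E]
  have hΛapply : ∀ a, Λ a = ∑ i, a i * π ((c i).1 τ) := fun a => by
    change Fintype.linearCombination (ZMod p) _ a = _
    rw [Fintype.linearCombination_apply]
    simp only [smul_eq_mul]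
  -- the integral combination `ψ_a = Σ ãᵢ cᵢ` realising `a`
  have hcomb : ∀ (a : Fin n → ZMod p) (g : absoluteGaloisGroup K),
      π ((∑ i, (a i).val • c i : contOneCocycles ρ.toTopRep).1 g) = ∑ i, a i * π ((c i).1 g) := by
    intro a g
    let ev : contOneCocycles ρ.toTopRep →+ M :=
      { toFun := fun ψ => ψ.1 g, map_zero' := rfl, map_add' := fun _ _ => rfl }
    have h1 : (∑ i, (a i).val • c i : contOneCocycles ρ.toTopRep).1 g =
        ∑ i, (a i).val • (c i).1 g := by
      change ev (∑ i, (a i).val • c i) = ∑ i, (a i).val • ev (c i)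
      rw [map_sum]
      exact Finset.sum_congr rfl fun i _ => map_nsmul ev _ _
    rw [h1, map_sum]
    refine Finset.sum_congr rfl fun i _ => ?_
    rw [map_nsmul, nsmul_eq_mul, ZMod.natCast_zmod_val]
  -- each `F a` is a homomorphism on `ker ρ ⊓ 𝒰`
  have hFmul : ∀ a (g h : GF), F a (g * h) = F a g + F a h := by
    intro a g h
    rw [hFapply, hFapply, hFapply, ← Finset.sum_add_distrib]
    refine Finset.sum_congr rfl fun i _ => ?_
    rw [Subgroup.coe_mul, apply_mul_of_apply_eq_one (c i) ((hmemGF g).mp g.2).1, map_add, mul_add]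
  -- compatibility `F a = 0 → Λ a = 0` (key lemma applied to `ψ_a`)
  have hFΛ : ∀ a, F a = 0 → Λ a = 0 := by
    intro a ha
    set ψ : contOneCocycles ρ.toTopRep := ∑ i, (a i).val • c i with hψ_def
    have hψ : oneCocycleClass ρ.toTopRep ψ = 0 := by
      refine oneCocycleClass_eq_zero_of_forall_mem_subgroup_apply_mem_range ρ 𝒰 e hirr hH3 ψ
        fun g hg hgU => ?_
      rw [← hπ0, hψ_def, hcomb]
      have := congrFun ha ⟨g, (hmemGF g).mpr ⟨hg, hgU⟩⟩
      rwa [hFapply] at this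
    obtain ⟨v, hv⟩ := (oneCocycleClass_eq_zero_iff _ ψ).mp hψ
    rw [hΛapply, ← hcomb, ← hψ_def, hπ0, hv τ]
    exact ⟨v, rfl⟩
  -- non-degeneracy `F eᵢ ≠ 0` (key lemma applied to `cᵢ`)
  have hFne : ∀ i, F (Pi.single i 1) ≠ 0 := by
    intro i h0
    refine hc i (oneCocycleClass_eq_zero_of_forall_mem_subgroup_apply_mem_range ρ 𝒰 e hirr hH3
      (c i) ?_)
    intro g hg hgU
    rw [← hπ0]
    have := congrFun h0 ⟨g, (hmemGF g).mpr ⟨hg, hgU⟩⟩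
    change (Fintype.linearCombination (ZMod p) E (Pi.single i 1)) _ = 0 at this
    rwa [Fintype.linearCombination_apply_single, one_smul] at this
  -- file 1
  obtain ⟨g, hg⟩ := exists_forall_apply_add_ne_zero hn F hFmul Λ hFΛ hFne
  refine ⟨g, ((hmemGF g).mp g.2).1, ((hmemGF g).mp g.2).2, fun i hi => ?_⟩
  apply hg i
  have h1 : F (Pi.single i 1) g = π ((c i).1 g) := by
    change (Fintype.linearCombination (ZMod p) E (Pi.single i 1)) g = _
    rw [Fintype.linearCombination_apply_single, one_smul]
  have h2 : Λ (Pi.single i 1) = π ((c i).1 τ) := by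
    change Fintype.linearCombination (ZMod p) _ (Pi.single i 1) = _
    rw [Fintype.linearCombination_apply_single, one_smul]
  rw [h1, h2, add_comm, hπ, hπ, ← map_add, ← mk_apply_mul_eq τ _ (c i), ← hπ, hπ0]
  exact hi

/-! ## §2 The thinned prime choice over a number field (Chebotarev) -/

variable [NumberField K]

/-- **One prime of Sakamoto's `𝒫` outside any finite set `T` with `loc_𝔮 cᵢ ≠ 0` for all `i` AND
a Frobenius in the coset `τ·(ker ρ ⊓ 𝒰)`** (T-C55K file 4 with the open set `U ∋ τγ` shrunk by
the clause `(τγ)⁻¹σ ∈ 𝒰`; `𝒰` open, normal, `≤ Gal(K̄/K(μ_N))`, (H.3)^𝒰). [cite: Sakamoto2024, Lemma 5.2 (p. 928)]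
[cite: MazurRubin2004, Prop. 3.6.1 proof, pp. 30–31] [cite: SerreAbelianLadic1968, Ch. I §2.2, Cor. 2 (a)] -/
theorem exists_mem_frobeniusClassPrimes_notMem_forall_localization_ne_zero_of_subgroup [Finite M]
    {p : ℕ} [Fact p.Prime] {N : ℕ} (hN : N ≠ 0)
    (S : Set (HeightOneSpectrum (𝓞 K))) (hS : S.Finite)
    (𝒰 : Subgroup (absoluteGaloisGroup K)) [𝒰.Normal]
    (h𝒰 : IsOpen (𝒰 : Set (absoluteGaloisGroup K))) (h𝒰N : 𝒰 ≤ rootsOfUnityFixer K N)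
    {τ : absoluteGaloisGroup K} (e : cokerSubOne ρ τ ≃+ ZMod p)
    (hirr : ∀ A : AddSubgroup M,
      (∀ (s : absoluteGaloisGroup K), ∀ m ∈ A, ρ s m ∈ A) → A = ⊥ ∨ A = ⊤)
    (hH3 : ∀ f : contOneCocycles ρ.toTopRep,
      (∀ u : absoluteGaloisGroup K, ρ u = 1 → u ∈ 𝒰 → f.1 u = 0) →
        oneCocycleClass ρ.toTopRep f = 0)
    {n : ℕ} (hn : n ≤ p) (c : Fin n → contOneCocycles ρ.toTopRep)
    (hc : ∀ i, oneCocycleClass ρ.toTopRep (c i) ≠ 0)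
    (T : Set (HeightOneSpectrum (𝓞 K))) (hT : T.Finite) :
    ∃ q ∈ frobeniusClassPrimes ρ S τ N, q ∉ T ∧
      (∀ i, galoisCohomology.localization ρ (Sum.inr q) 1 (oneCocycleClass ρ.toTopRep (c i)) ≠ 0) ∧
      ∃ 𝔓 ∈ q.primesAbove, ∃ σ : absoluteGaloisGroup K,
        IsArithFrobAt (𝓞 K) σ 𝔓 ∧ ρ (σ * τ⁻¹) = 1 ∧ σ * τ⁻¹ ∈ 𝒰 := by
  classical
  -- Step 1: the selection inside `ker ρ ⊓ 𝒰`
  obtain ⟨γ, hγρ, hγU, hγ⟩ := exists_mem_subgroup_forall_apply_mul_notMem_range ρ 𝒰 e hirr hH3 hn c hc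
  set g₀ : absoluteGaloisGroup K := τ * γ with hg₀
  have hρg₀ : ρ g₀ = ρ τ := by rw [hg₀, map_mul, hγρ, mul_one]
  -- Step 2: the open set `U ∋ g₀`
  set U : Set (absoluteGaloisGroup K) :=
    {σ | (∀ m : M, ρ σ m = ρ g₀ m) ∧ g₀⁻¹ * σ ∈ 𝒰 ∧ ∀ i, (c i).1 σ = (c i).1 g₀}
    with hU_def
  haveI : NeZero N := ⟨hN⟩
  have hUopen : IsOpen U := by
    have h1 : IsOpen {σ : absoluteGaloisGroup K | ∀ m : M, ρ σ m = ρ g₀ m} := by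
      have heq : {σ : absoluteGaloisGroup K | ∀ m : M, ρ σ m = ρ g₀ m} =
          (fun σ => g₀⁻¹ * σ) ⁻¹' ⋂ m : M, {σ | ρ σ m = m} := by
        ext σ
        simp only [Set.mem_setOf_eq, Set.mem_preimage, Set.mem_iInter, map_mul,
          Module.End.mul_apply]
        refine forall_congr' fun m => ⟨fun h => ?_, fun h => ?_⟩
        · rw [h, ← Module.End.mul_apply, ← map_mul, inv_mul_cancel, map_one, Module.End.one_apply]
        · have h' := congrArg (ρ g₀) h
          rwa [← Module.End.mul_apply, ← map_mul, mul_inv_cancel, map_one, Module.End.one_apply] at h'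
      rw [heq]
      exact (isOpen_iInter_of_finite fun m => ρ.isOpen_setOf_apply_eq m).preimage
        (continuous_const.mul continuous_id)
    have h2 : IsOpen {σ : absoluteGaloisGroup K | g₀⁻¹ * σ ∈ 𝒰} :=
      h𝒰.preimage (continuous_const.mul continuous_id)
    have h3 : IsOpen {σ : absoluteGaloisGroup K | ∀ i, (c i).1 σ = (c i).1 g₀} := by
      have heq : {σ : absoluteGaloisGroup K | ∀ i, (c i).1 σ = (c i).1 g₀} =
          ⋂ i, (c i).1 ⁻¹' {(c i).1 g₀} := by
        ext σ; simp [Set.mem_iInter]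
      rw [heq]
      exact isOpen_iInter_of_finite fun i => (isOpen_discrete _).preimage (c i).1.continuous
    simpa only [hU_def, Set.setOf_and] using h1.inter (h2.inter h3)
  have hg₀U : g₀ ∈ U := ⟨fun _ => rfl, by rw [inv_mul_cancel]; exact Subgroup.one_mem _, fun _ => rfl⟩
  -- Step 3: the finite set of bad places and a Frobenius in `U` away from it
  set B : Set (HeightOneSpectrum (𝓞 K)) :=
    S ∪ T ∪ {v | ((N : ℕ) : 𝓞 K) ∈ v.asIdeal} ∪ {v | ¬ GaloisRep.IsUnramifiedAt v ρ} ∪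
      {v | ¬ ∀ i, ∀ 𝔓 ∈ v.primesAbove, ∀ g ∈ 𝔓.inertia (absoluteGaloisGroup K), (c i).1 g = 0}
    with hB_def
  have hBfin : B.Finite := by
    refine (((hS.union hT).union (finite_setOf_natCast_mem (K := K) (m := N))).union ?_).union ?_
    · exact eventually_cofinite.1 (eventually_isUnramifiedAt ρ)
    · exact eventually_cofinite.1
        (eventually_all.2 fun i => eventually_forall_inertia_apply_eq_zero ρ (c i))
  have hdense := absoluteGaloisGroup.frobenius_dense
    Literature.NumberTheory.Automorphic.chebotarev_artinRep_of_galoisSide K B hBfin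
  obtain ⟨σ, ⟨v, hvB, 𝔓, h𝔓, hσ𝔓⟩, hσU⟩ := hdense.exists_mem_open hUopen ⟨g₀, hg₀U⟩
  simp only [hB_def, Set.mem_union, Set.mem_setOf_eq, not_or, not_not] at hvB
  obtain ⟨⟨⟨⟨hvS, hvT⟩, hvN⟩, hunr⟩, hcI⟩ := hvB
  obtain ⟨hσρ, hσ𝒰, hσc⟩ := hσU
  have hρσ : ρ σ = ρ τ := (LinearMap.ext hσρ).trans hρg₀
  -- `σ τ⁻¹ = τ (γ (g₀⁻¹ σ)) τ⁻¹ ∈ 𝒰` (normality) and `ρ (σ τ⁻¹) = 1`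
  have hστU : σ * τ⁻¹ ∈ 𝒰 := by
    have hmem : γ * (g₀⁻¹ * σ) ∈ 𝒰 := Subgroup.mul_mem _ hγU hσ𝒰
    have heq : σ * τ⁻¹ = τ * (γ * (g₀⁻¹ * σ)) * τ⁻¹ := by
      rw [hg₀]; group
    rw [heq]
    exact Subgroup.Normal.conj_mem inferInstance _ hmem τ
  have hρστ : ρ (σ * τ⁻¹) = 1 := by
    rw [map_mul, hρσ, ← map_mul, mul_inv_cancel, map_one]
  -- Step 4: `v ∈ 𝒫`, the localisations are non-zero, and the Frobenius lies in the coset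
  refine ⟨v, ⟨hvS, hvN, hunr, σ, ⟨𝔓, h𝔓, hσ𝔓⟩, fun m => ?_, fun ζ hζ => ?_⟩, hvT, fun i => ?_,
    𝔓, h𝔓, σ, hσ𝔓, hρστ, hστU⟩
  · rw [hρστ, Module.End.one_apply]
  · exact (mem_rootsOfUnityFixer_iff.mp (h𝒰N hστU)) ζ hζ
  · rw [Ne, localization_oneCocycleClass_eq_zero_iff_of_isArithFrobAt ρ v hunr (c i) (hcI i) h𝔓 hσ𝔓,
      hσc i, hρσ]
    exact hγ i

/-- **THE THINNED PRIME CHOICE — THEOREM.**  `K` a number field, `T̄` finite with (H.1), `τ` with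
`T̄/(τ − 1)T̄ ≃ ℤ/p`, `N ≠ 0`, `S` finite, `𝒰 ≤ Gal(K̄/K(μ_N))` OPEN NORMAL with (H.3)^𝒰, `n ≤ p`
NON-ZERO classes `cᵢ ∈ H¹(K, T̄)`: **infinitely many `𝔮 ∈ frobeniusClassPrimes ρ S τ N` have
`loc_𝔮 cᵢ ≠ 0` for every `i` and an arithmetic Frobenius `σ` above `𝔮` with `σ τ⁻¹ ∈ ker ρ ⊓ 𝒰`**
("`Frob_𝔮` acts on `K′ = K̄^𝒰` as `τ` does").  `𝒰 = Gal(K̄/K(μ_N))` is T-C55K's theorem.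
[cite: Sakamoto2024, Lemma 5.2 and Cor. 5.5 (pp. 928–930)]
[cite: MazurRubin2004, Prop. 3.6.1 (pp. 30–31)] [cite: SerreAbelianLadic1968, Ch. I §2.2, Cor. 2 (a)] -/
theorem infinite_setOf_mem_frobeniusClassPrimes_forall_localization_ne_zero_of_subgroup [Finite M]
    {p : ℕ} [Fact p.Prime] {N : ℕ} (hN : N ≠ 0)
    (S : Set (HeightOneSpectrum (𝓞 K))) (hS : S.Finite)
    (𝒰 : Subgroup (absoluteGaloisGroup K)) [𝒰.Normal]
    (h𝒰 : IsOpen (𝒰 : Set (absoluteGaloisGroup K))) (h𝒰N : 𝒰 ≤ rootsOfUnityFixer K N)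
    {τ : absoluteGaloisGroup K} (hτ : Nonempty (cokerSubOne ρ τ ≃+ ZMod p))
    (hirr : ∀ A : AddSubgroup M,
      (∀ (s : absoluteGaloisGroup K), ∀ m ∈ A, ρ s m ∈ A) → A = ⊥ ∨ A = ⊤)
    (hH3 : ∀ f : contOneCocycles ρ.toTopRep,
      (∀ u : absoluteGaloisGroup K, ρ u = 1 → u ∈ 𝒰 → f.1 u = 0) →
        oneCocycleClass ρ.toTopRep f = 0)
    {n : ℕ} (hn : n ≤ p) (c : Fin n → galoisCohomology ρ 1) (hc : ∀ i, c i ≠ 0) :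
    {q | q ∈ frobeniusClassPrimes ρ S τ N ∧
      (∀ i, galoisCohomology.localization ρ (Sum.inr q) 1 (c i) ≠ 0) ∧
      ∃ 𝔓 ∈ q.primesAbove, ∃ σ : absoluteGaloisGroup K,
        IsArithFrobAt (𝓞 K) σ 𝔓 ∧ ρ (σ * τ⁻¹) = 1 ∧ σ * τ⁻¹ ∈ 𝒰}.Infinite := by
  classical
  choose φ hφ using fun i => oneCocycleClass_surjective ρ.toTopRep (c i)
  have hφne : ∀ i, oneCocycleClass ρ.toTopRep (φ i) ≠ 0 := fun i => by rw [hφ i]; exact hc i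
  intro hfin
  obtain ⟨q, hq, hqT, hloc, hfrob⟩ :=
    exists_mem_frobeniusClassPrimes_notMem_forall_localization_ne_zero_of_subgroup ρ hN S hS 𝒰 h𝒰
      h𝒰N hτ.some hirr hH3 hn φ hφne _ hfin
  exact hqT ⟨hq, fun i => by rw [← hφ i]; exact hloc i, hfrob⟩

/-! ## §3 (H.3)^𝒰 from (H.3): thinning by a subgroup with "abelian" quotient costs nothing -/

omit [NumberField K] in
/-- **On `ker ρ ⊓ 𝒰₀` a cocycle vanishing on `ker ρ ⊓ 𝒰₀ ⊓ 𝒦` vanishes**, if the commutators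
`g u g⁻¹ u⁻¹` (`g ∈ 𝒱`, `u ∈ ker ρ ⊓ 𝒰₀`) lie in `𝒦` and `T̄^{ρ(𝒱)} = 0`:
`ρ(g) f(u) = f(g u g⁻¹) = f([g,u] u) = f(u)` (equivariance of `f|_{ker ρ}`, T-C55K file 2).
[cite: MazurRubin2004, Prop. 3.6.1 proof, p. 31] -/
theorem forall_apply_eq_zero_of_forall_mem_subgroup_apply_eq_zero
    (𝒰₀ 𝒦 : Subgroup (absoluteGaloisGroup K)) [𝒰₀.Normal] [𝒦.Normal]
    (𝒱 : Set (absoluteGaloisGroup K))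
    (hcomm : ∀ g ∈ 𝒱, ∀ u : absoluteGaloisGroup K, ρ u = 1 → u ∈ 𝒰₀ → g * u * g⁻¹ * u⁻¹ ∈ 𝒦)
    (hfix : ∀ m : M, (∀ g ∈ 𝒱, ρ g m = m) → m = 0)
    (f : contOneCocycles ρ.toTopRep)
    (hf : ∀ u : absoluteGaloisGroup K, ρ u = 1 → u ∈ 𝒰₀ → u ∈ 𝒦 → f.1 u = 0) :
    ∀ u : absoluteGaloisGroup K, ρ u = 1 → u ∈ 𝒰₀ → f.1 u = 0 := by
  intro u hu hu₀
  refine hfix (f.1 u) fun g hg => ?_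
  -- `w = g u g⁻¹ u⁻¹ ∈ ker ρ ⊓ 𝒰₀ ⊓ 𝒦`, so `f(w) = 0`
  have huinv : ρ u⁻¹ = 1 := by
    have h := map_mul ρ u⁻¹ u
    rw [inv_mul_cancel, map_one, hu, mul_one] at h
    exact h.symm
  have hconjρ : ρ (g * u * g⁻¹) = 1 := by
    rw [map_mul, map_mul, hu, mul_one, ← map_mul, mul_inv_cancel, map_one]
  have hwρ : ρ (g * u * g⁻¹ * u⁻¹) = 1 := by rw [map_mul, hconjρ, huinv, mul_one]
  have hw₀ : g * u * g⁻¹ * u⁻¹ ∈ 𝒰₀ :=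
    Subgroup.mul_mem _ (Subgroup.Normal.conj_mem inferInstance u hu₀ g) (Subgroup.inv_mem _ hu₀)
  have hfw : f.1 (g * u * g⁻¹ * u⁻¹) = 0 := hf _ hwρ hw₀ (hcomm g hg u hu hu₀)
  -- `f(g u g⁻¹) = f(w u) = f(w) + f(u) = f(u)` and `f(g u g⁻¹) = ρ(g) f(u)`
  have h1 : f.1 (g * u * g⁻¹) = f.1 u := by
    have heq : g * u * g⁻¹ = g * u * g⁻¹ * u⁻¹ * u := by group
    rw [heq, apply_mul_of_apply_eq_one f hwρ u, hfw, zero_add]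
  rw [← apply_conj_of_apply_eq_one f hu g, h1]

omit [NumberField K] in
/-- **(H.3)^{𝒰₀ ⊓ 𝒦} from (H.3)^{𝒰₀}** (`𝒰₀ = Gal(K̄/K(μ_N))`: T-C55K's (H.3), discharged for `E[p]`
by `InflationRestrictionSakamotoH3`), given `hcomm` (commutators `[𝒱, ker ρ ⊓ 𝒰₀] ⊆ 𝒦`, normal)
and `hfix` (`T̄^{ρ(𝒱)} = 0`) — the (H.3) input of §2 for the thinned group `𝒰 = 𝒰₀ ⊓ 𝒦`.  Intended
instance: `K = ℚ`, `T̄ = E[3]`, `𝒰₀ = 𝒱 = Gal(ℚ̄/ℚ(μ₃))`, `𝒦 = Gal(ℚ̄/K′)`, `K′/ℚ(μ₃)` ABELIAN.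
[cite: MazurRubin2004, Prop. 3.6.1 proof, p. 31] [cite: Sakamoto2024, Lemma 5.2 (p. 928)] -/
theorem hH3_inf_of_hH3 (𝒰₀ 𝒦 : Subgroup (absoluteGaloisGroup K)) [𝒰₀.Normal] [𝒦.Normal]
    (𝒱 : Set (absoluteGaloisGroup K))
    (hcomm : ∀ g ∈ 𝒱, ∀ u : absoluteGaloisGroup K, ρ u = 1 → u ∈ 𝒰₀ → g * u * g⁻¹ * u⁻¹ ∈ 𝒦)
    (hfix : ∀ m : M, (∀ g ∈ 𝒱, ρ g m = m) → m = 0)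
    (hH3 : ∀ f : contOneCocycles ρ.toTopRep,
      (∀ u : absoluteGaloisGroup K, ρ u = 1 → u ∈ 𝒰₀ → f.1 u = 0) →
        oneCocycleClass ρ.toTopRep f = 0) :
    ∀ f : contOneCocycles ρ.toTopRep,
      (∀ u : absoluteGaloisGroup K, ρ u = 1 → u ∈ 𝒰₀ ⊓ 𝒦 → f.1 u = 0) →
        oneCocycleClass ρ.toTopRep f = 0 := by
  intro f hf
  refine hH3 f (forall_apply_eq_zero_of_forall_mem_subgroup_apply_eq_zero ρ 𝒰₀ 𝒦 𝒱 hcomm hfix f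
    fun u hu hu₀ hu𝒦 => hf u hu (Subgroup.mem_inf.mpr ⟨hu₀, hu𝒦⟩))

end Summit.BirchSwinnertonDyer.Rank1Residual.GaloisImage.PrimeChoice

end
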